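import Literature.MathematicalPhysics.QuantumManyBody.NeumannMomentumCutoffs
import HarnessLib

/-!
# The `N`-body dictionary of the Neumann eigenbasis: `∑_k n_k = N`, `∑_k |p_k|² n_k = ⟨Ψ,TΨ⟩`, `n_0 = ⟨Ψ,n₀Ψ⟩`

Topic `Literature/MathematicalPhysics/QuantumManyBody`, grouping namespace `NeumannBox` (provefact
`Literature.MathematicalPhysics.QuantumManyBody.BoseGas.Junge2026_neumannBox_pinnedLowerBound`;
fifth brick of the operator layer of [FournaisEtAl2024, §2], theorems only, on top of
`NeumannMomentumCutoffs.lean`). The second quantisation of [FournaisEtAl2024, Lemma 2.8] writes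
`H_N` on the bosonic Fock space over the Neumann eigenbasis `(u_k)` of `Λ = [0,ℓ]³`; what it uses of
the one-particle structure is the dictionary `𝒩 = ∑_k a†(u_k)a(u_k)`,
`∑ⱼ(-Δⱼ) = ∑_k |p_k|² a†(u_k)a(u_k)` (`p_k = (π/ℓ)k`, (2.20)–(2.21)) and `n₀ = a†(u_0)a(u_0)` (2.9).
Here these identities are PROVED in expectation, in the slice form of the topic (the `j`-th
particle's mode coefficient `⟨u_k, Ψ(X;·ⱼ)⟩ = modeCoeff ℓ k (Ψ(X;·ⱼ))`, the others integrated over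
`Λ^N` with the weight `ℓ⁻³`, exactly as `depletion`, `nPlusLow`, `nPlusHigh`) — the Neumann-box
analogue of layer C of `TorusBoseFockLayer.lean` (plane waves on the torus), so that the generic
Fock layer `BoseGas.Fock` of that file can be instantiated over `ι = ℕ₀³` with these occupations:

* `sum_lintegral_tsum_enorm_sq_modeCoeff_update` — `∑ⱼ ℓ⁻³∫_{Λ^N} ∑_k |⟨u_k,Ψ(X;·ⱼ)⟩|² = N ∫_{Λ^N}|Ψ|²`
  (fibrewise Parseval + slice integration); `= N` for a Neumann trial state
  (`…_trialState`);
* `sum_lintegral_tsum_waveNumber_sq_mul_enorm_sq_modeCoeff_update` —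
  `∑ⱼ ℓ⁻³∫_{Λ^N} ∑_k |p_k|² |⟨u_k,Ψ(X;·ⱼ)⟩|² = ∫_{Λ^N} |∇Ψ|²` for `Ψ ∈ C¹` (fibrewise form
  identity, chain rule for slices);
* `sum_lintegral_enorm_sq_modeCoeff_zero_update` — the zero mode is the condensate:
  `∑ⱼ ℓ⁻³∫ |⟨u_0,Ψ(X;·ⱼ)⟩|² = condensateOccupation N ℓ Ψ` for Bose-symmetric `Ψ`;
* `condensateOccupation_add_sum_lintegral_tsum_ne_zero` — `⟨Ψ,n₀Ψ⟩ + ∑_{k ≠ 0}(…) = N` for a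
  normalised Bose-symmetric Neumann state (`n₀ + n₊ = N` mode by mode).

No definitions.

## References

* [FournaisEtAl2024] S. Fournais, L. Junge, T. Girardot, L. Morin, M. Olivieri, A. Triay, *The free
  energy of dilute Bose gases at low temperatures interacting via strong potentials*,
  arXiv:2408.14222, Ann. Henri Poincaré (2026): (2.9), (2.20)–(2.21), Lemma 2.8.
* [LSSY2005] E. H. Lieb, R. Seiringer, J. P. Solovej, J. Yngvason, *The Mathematics of the Bose Gas
  and its Condensation*, Birkhäuser 2005: Ch. 5 (5.17); App. A (A.9)–(A.13).
-/

noncomputable section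

open Real intervalIntegral MeasureTheory Set Filter Topology Complex
open scoped ENNReal NNReal

namespace Literature.MathematicalPhysics.QuantumManyBody.NeumannBox

section Dictionary

open Literature.MathematicalPhysics.QuantumManyBody.BoseGas

variable {N : ℕ}

/-- **`∑_k a†(u_k)a(u_k) = 𝒩`** in expectation, slice form: for continuous `Ψ` on the Neumann box,
`∑ᵢ ℓ⁻³ ∫_{Λ^N} ∑_k |⟨u_k, Ψ(X;·ᵢ)⟩|² dX = N ∫_{Λ^N} |Ψ|²` (fibrewise Parseval and slice
integration). [cite: FournaisEtAl2024, (2.20) and Lemma 2.8] -/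
theorem sum_lintegral_tsum_enorm_sq_modeCoeff_update {ℓ : ℝ} (hℓ : 0 < ℓ) {Ψ : Config N → ℂ}
    (hΨ : Continuous Ψ) :
    ∑ i : Fin N, (ENNReal.ofReal ℓ ^ 3)⁻¹ *
        ∫⁻ X in cellN N ℓ, ∑' k, ‖modeCoeff ℓ k fun y => Ψ (Function.update X i y)‖ₑ ^ 2 =
      N * ∫⁻ X in cellN N ℓ, ‖Ψ X‖ₑ ^ 2 := by
  have hL3 : ENNReal.ofReal ℓ ^ 3 ≠ 0 := pow_ne_zero _ (by simpa using hℓ)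
  have hL3' : ENNReal.ofReal ℓ ^ 3 ≠ ⊤ := ENNReal.pow_ne_top ENNReal.ofReal_ne_top
  have hterm : ∀ i : Fin N, (ENNReal.ofReal ℓ ^ 3)⁻¹ *
      ∫⁻ X in cellN N ℓ, ∑' k, ‖modeCoeff ℓ k fun y => Ψ (Function.update X i y)‖ₑ ^ 2 =
        ∫⁻ X in cellN N ℓ, ‖Ψ X‖ₑ ^ 2 := by
    intro i
    have hfib : ∀ X : Config N, ∑' k, ‖modeCoeff ℓ k fun y => Ψ (Function.update X i y)‖ₑ ^ 2 =
        ∫⁻ x in cell ℓ, ‖Ψ (Function.update X i x)‖ₑ ^ 2 := fun X =>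
      tsum_enorm_sq_modeCoeff hℓ (hΨ.comp (continuous_const.update i continuous_id))
    simp_rw [hfib]
    rw [lintegral_cellN_lintegral_update i (H := fun X => ‖Ψ X‖ₑ ^ 2)
        (hΨ.measurable.enorm.pow_const 2), ← mul_assoc, ENNReal.inv_mul_cancel hL3 hL3', one_mul]
  simp only [hterm, Finset.sum_const, Finset.card_univ, Fintype.card_fin, nsmul_eq_mul]

/-- For a Neumann trial state (normalised on the box): **`∑ᵢ ℓ⁻³ ∫ ∑_k |⟨u_k, Ψ(X;·ᵢ)⟩|² = N`**,
i.e. `⟨Ψ, ∑_k a†_k a_k Ψ⟩ = N`. [cite: FournaisEtAl2024, Lemma 2.8] -/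
theorem sum_lintegral_tsum_enorm_sq_modeCoeff_update_trialState {ℓ : ℝ} (hℓ : 0 < ℓ)
    (Ψ : NeumannTrialState N ℓ) :
    ∑ i : Fin N, (ENNReal.ofReal ℓ ^ 3)⁻¹ *
        ∫⁻ X in cellN N ℓ, ∑' k, ‖modeCoeff ℓ k fun y => Ψ.ψ (Function.update X i y)‖ₑ ^ 2 =
      N := by
  rw [sum_lintegral_tsum_enorm_sq_modeCoeff_update hℓ Ψ.contDiff.continuous,
    ← setLIntegral_congr (boxN_ae_eq_cellN N ℓ)]
  have h := Ψ.norm_eq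
  simp only [← enorm_eq_nnnorm] at h
  rw [h, mul_one]

/-- **`∑_k |p_k|² a†(u_k)a(u_k) = ∑ⱼ(-Δⱼ)`** in expectation, slice form: for `Ψ ∈ C¹`,
`∑ᵢ ℓ⁻³ ∫_{Λ^N} ∑_k |p_k|² |⟨u_k, Ψ(X;·ᵢ)⟩|² dX = ∫_{Λ^N} |∇Ψ|²` (fibrewise form identity, the
chain rule for slices and slice integration). [cite: FournaisEtAl2024, (2.20)–(2.21) and Lemma 2.8] -/
theorem sum_lintegral_tsum_waveNumber_sq_mul_enorm_sq_modeCoeff_update {ℓ : ℝ} (hℓ : 0 < ℓ)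
    {Ψ : Config N → ℂ} (hΨ : ContDiff ℝ 1 Ψ) :
    ∑ i : Fin N, (ENNReal.ofReal ℓ ^ 3)⁻¹ *
        ∫⁻ X in cellN N ℓ, ∑' k, ENNReal.ofReal (∑ j, waveNumber ℓ (k j) ^ 2) *
          ‖modeCoeff ℓ k fun y => Ψ (Function.update X i y)‖ₑ ^ 2 =
      ∫⁻ X in cellN N ℓ, kineticDensity Ψ X := by
  rw [← sum_lintegral_gradSqC_slice hℓ (hΨ.differentiable one_ne_zero)]
  refine Finset.sum_congr rfl fun i _ => ?_
  congr 1
  refine lintegral_congr fun X => ?_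
  exact tsum_sum_waveNumber_sq_mul_enorm_sq_modeCoeff hℓ (hΨ.comp (contDiff_update 1 X i))

/-- **The zero mode is the condensate: `ℓ⁻³∑ᵢ ∫ |⟨u_0, Ψ(X;·ᵢ)⟩|² = ⟨Ψ, n₀Ψ⟩`** for a
Bose-symmetric continuous `Ψ` (`u_0 = ℓ^{-3/2}`, so `|⟨u_0,f⟩|² = ℓ⁻³|∫_Λ f|²`, and the symmetrised
slice averages give `condensateOccupation`). [cite: FournaisEtAl2024, (2.9) and Lemma 2.8] -/
theorem sum_lintegral_enorm_sq_modeCoeff_zero_update {n : ℕ} {ℓ : ℝ} (hℓ : 0 < ℓ)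
    {Ψ : Config (n + 1) → ℂ} (hΨ : Continuous Ψ)
    (hsymm : ∀ (σ : Equiv.Perm (Fin (n + 1))) (X : Config (n + 1)), Ψ (X ∘ σ) = Ψ X) :
    ∑ i : Fin (n + 1), (ENNReal.ofReal ℓ ^ 3)⁻¹ *
        ∫⁻ X in cellN (n + 1) ℓ, ‖modeCoeff ℓ 0 fun y => Ψ (Function.update X i y)‖ₑ ^ 2 =
      condensateOccupation (n + 1) ℓ Ψ := by
  rw [← sum_lintegral_sliceMeanSq_of_symm hℓ hΨ hsymm]
  refine Finset.sum_congr rfl fun i _ => ?_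
  congr 1
  refine lintegral_congr fun X => ?_
  rw [enorm_sq_modeCoeff_zero hℓ, enorm_eq_nnnorm]

/-- **`⟨Ψ,n₀Ψ⟩ = N - ⟨Ψ,n₊Ψ⟩` mode by mode:** for a normalised Bose-symmetric Neumann state,
`⟨Ψ,n₀Ψ⟩ + ∑ᵢ ℓ⁻³∫ ∑_{k ≠ 0} |⟨u_k, Ψ(X;·ᵢ)⟩|² = N`. [cite: FournaisEtAl2024, (2.9) and Lemma 2.8] -/
theorem condensateOccupation_add_sum_lintegral_tsum_ne_zero {n : ℕ} {ℓ : ℝ} (hℓ : 0 < ℓ)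
    (Ψ : NeumannTrialState (n + 1) ℓ)
    (hsymm : ∀ (σ : Equiv.Perm (Fin (n + 1))) (X : Config (n + 1)), Ψ.ψ (X ∘ σ) = Ψ.ψ X) :
    condensateOccupation (n + 1) ℓ Ψ.ψ +
        ∑ i : Fin (n + 1), (ENNReal.ofReal ℓ ^ 3)⁻¹ *
          ∫⁻ X in cellN (n + 1) ℓ, ∑' k, (if k = 0 then 0 else
            ‖modeCoeff ℓ k fun y => Ψ.ψ (Function.update X i y)‖ₑ ^ 2) =
      ((n + 1 : ℕ) : ℝ≥0∞) := by
  have hcont := Ψ.contDiff.continuous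
  rw [← sum_lintegral_tsum_enorm_sq_modeCoeff_update_trialState hℓ Ψ,
    ← sum_lintegral_enorm_sq_modeCoeff_zero_update hℓ hcont hsymm, ← Finset.sum_add_distrib]
  refine Finset.sum_congr rfl fun i _ => ?_
  rw [← mul_add, ← lintegral_add_left (((measurable_modeCoeff_update ℓ 0 i hcont).enorm.pow_const 2))]
  congr 1
  refine lintegral_congr fun X => ?_
  conv_rhs => rw [ENNReal.tsum_eq_add_tsum_ite (0 : Fin 3 → ℕ)]
  congr 1
  exact tsum_congr fun k => by congr

end Dictionary

end Literature.MathematicalPhysics.QuantumManyBody.NeumannBox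

end
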